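import Summits.BirchSwinnertonDyer.BirchSwinnertonDyer.Theorems.BiquadraticEisensteinDescentHeegnerTwistCouplingInSupplySymbolicMonskyMuOneLaplacian
import Summits.BirchSwinnertonDyer.BirchSwinnertonDyer.Theorems.BiquadraticEisensteinDescentHeegnerTwistCouplingInSupplySymbolicMonskyDesignDual
import HarnessLib

set_option linter.dupNamespace false -- `Summit.BirchSwinnertonDyer.BirchSwinnertonDyer.Theorems.…` (summit = sub)
set_option autoImplicit false

/-!
# Crux `HeegnerTwistCouplingInSupply` (stmt-BirchSwinnertonDyer-21381) — THEOREM B, the two cases: closure-certified designs for a `μ = 1` base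
# from a complement of `ker L` (case β, `d ⊥ A`) or of `A` through `1 + a₁` (case α, `⟨d, a₁⟩ = 1`)

Route `BiquadraticEisensteinDescent` (cell `pub/bsd-wall`, width seat `bsd-wall-cm-bed-w3` g23; `--supports` 21381, helper). The heart of the
uniform existence theorem `…SymbolicMonskyMuOneExists`. Setting (`…SymbolicMonskyMuOneLaplacian`): `μ = 1` base, Laplacian `L` symmetric,
virtual kernel `𝒦 = {(u, w) : u_(b₀) = 0, Lw = 0, Lu = D_d w}`, `A := ker L ∩ {u_(b₀) = 0}`, `ker L = A ⊕ ⟨1⟩`; a design is a dual family `f_i`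
(free cells) plus `δ` (`…SymbolicMonskyDesignDual.design_of_stages_dual`), `Z := ⋂ ker f_i`.
* ★★ `muOne_design_beta` (case β): given `u` with `u_(b₀) = 0`, `Lu = d` (so `(u, 1) ∈ 𝒦`, `ε = 1`) and `f_i` cutting out a COMPLEMENT `Z` of
  `ker L`, the design `(f, δ := u + 1)` satisfies (W), (U), (F): (W) `E = Σ e_i f_i` kills `A` (pairs `(a, 0)`), `1` (pair `(u, 1)` against `δ`)
  and `Z`, so `E = 0`; (U)/(F) a kernel vector `y` with `y + γ1 ∈ Z` is `γ1`, then `s = Lx + γd = L(x + γu)` is orthogonal to `ker L`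
  (self-adjointness) and to `Z`, so `s = 0`; resp. `x + γu + γ1 ∈ Z ∩ ker L = 0` forces `γ = 0` at the coordinate `b₀`.
* ★★ `muOne_design_alpha` (case α): given `a₁ ∈ A` with `⟨d, a₁⟩ = 1`, `|d|` even, and `f_i` cutting out `Z ∋ 1 + a₁` with `Z ∩ ker L ⊆ {0, 1+a₁}`
  and `A + Z = V`, the design `(f, δ)` (any `δ`) satisfies (W), (U), (F): `d ∉ im L` (`⟨d, a₁⟩ = ⟨Lx, a₁⟩ = ⟨x, La₁⟩ = 0` otherwise); a kernel
  vector `y` with `y + γ1 ∈ Z` is `γ1` or `(1+γ)1 + a₁`, and the four sub-cases are killed by `⟨s, 1⟩ = (1+γ)|d| + ⟨d, a₁⟩ = 1` resp.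
  `⟨s, a₁⟩ = 1 = ⟨s, 1 + a₁⟩ + ⟨s, 1⟩ = 0`.
Both conclude `∃ c₁ rest, rest.length = τ ∧ heegnerK base (c₁ :: rest) ∧ ∀ pat, det M_odd = 1` (pattern-free Heegner recipe, `τ + 1` primes).
Numerics beforehand (work/signtable/muone_uniform.py, muone_exc.py): 760 random / exceptional `μ = 1` bases, `K ≤ 7`, closure order (w,u) and brute
force over all mutual patterns: 0 failures; `τ = κ_u + ε = t_pred − 1` in every case.

HONEST FRAMING: linear algebra over `𝔽₂`; RUNG-LEVEL corner layer (congruent `j = 1728` families); the crux (C⁺), its registered stubs and BSD are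
untouched; nothing is closed. THEOREMS ONLY. Reference: [HeathBrown1994] appendix (Monsky), typescript pp. 39–41.
-/

namespace Summit.BirchSwinnertonDyer.BirchSwinnertonDyer.Theorems.SymbolicMonsky

section MuOneDesign

open Matrix Module

variable {k : ℕ} (base : SymbData (k + 1))

/-- `a + c = 0 → a = c` in `𝔽₂`. -/
private theorem F2_eq_of_add_eq_zero₂ {a c : ZMod 2} (h : a + c = 0) : a = c := by
  revert a c; decide

/-- ★★ **THEOREM B, case (β) `d ⊥ A`.** A `μ = 1` base (`P_(b₀)` the only base prime `≡ 3 (mod 4)`) with a vector `u`, `u_(b₀) = 0`,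
`Lu = d` (so `(u, 1)` is a virtual kernel pair), and linearly independent linear forms `f_i` cutting out a complement `Z` of `ker L`
(hypotheses `hZS`: `Z ∩ ker L = 0`, `hSZ`: a form killing `ker L` and `Z` is zero): the design with free cells `f_i` and `δ = u + 1`
satisfies (W), (U), (F), hence is a pattern-free Heegner recipe with `τ + 1` auxiliary primes. [folklore] -/
theorem muOne_design_beta (b₀ : Fin (k + 1)) (hμ : ∀ b, negNegOne (base.cls b) = true ↔ b = b₀)
    (τ : ℕ) (f : Fin τ → Dual (ZMod 2) (Fin (k + 1) → ZMod 2)) (u : Fin (k + 1) → ZMod 2)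
    (hind : ∀ e : Fin τ → ZMod 2, (∑ i, e i • f i) = 0 → ∀ i, e i = 0)
    (hu : ∀ b, (∑ b', bz (base.neg b b') * (u b' + u b)) = bz (negTwo (base.cls b))) (hu0 : u b₀ = 0)
    (hZS : ∀ z : Fin (k + 1) → ZMod 2, (∀ i, f i z = 0) → (∀ b, (∑ b', bz (base.neg b b') * (z b' + z b)) = 0) → z = 0)
    (hSZ : ∀ φ : Dual (ZMod 2) (Fin (k + 1) → ZMod 2),
      (∀ s : Fin (k + 1) → ZMod 2, (∀ b, (∑ b', bz (base.neg b b') * (s b' + s b)) = 0) → φ s = 0) →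
      (∀ z : Fin (k + 1) → ZMod 2, (∀ i, f i z = 0) → φ z = 0) → φ = 0) :
    ∃ (c₁ : AuxCell) (rest : List AuxCell), rest.length = τ ∧ heegnerK base (c₁ :: rest) = true ∧
      ∀ pat : ℕ → ℕ → Bool, (dataK base (c₁ :: rest) pat).monskyOddS.det = 1 := by
  classical
  have hm := bz_negNegOne_eq base b₀ hμ
  -- `1 ∈ ker L`, `ker L` is stable under `+ γ·1`
  have hS_shift : ∀ (y : Fin (k + 1) → ZMod 2) (γ : ZMod 2), (∀ b, (∑ b', bz (base.neg b b') * (y b' + y b)) = 0) →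
      ∀ b, (∑ b', bz (base.neg b b') * ((y b' + γ) + (y b + γ))) = 0 := fun y γ hy b => by
    rw [lap_add_const base y γ b]; exact hy b
  -- linearity of the `f i` on `y + γ·1`
  have hf_shift : ∀ i (y : Fin (k + 1) → ZMod 2) (γ : ZMod 2), f i (fun b => y b + γ) = f i y + γ * f i (fun _ => 1) := by
    intro i y γ
    have : (fun b => y b + γ) = y + γ • (fun _ => (1 : ZMod 2)) := by
      funext b; simp [Pi.add_apply, Pi.smul_apply]
    rw [this, map_add, map_smul, smul_eq_mul]
  -- key: a vector `y ∈ ker L` with `y + γ1 ∈ Z` is `γ1`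
  have hy_const : ∀ (y : Fin (k + 1) → ZMod 2) (γ : ZMod 2), (∀ b, (∑ b', bz (base.neg b b') * (y b' + y b)) = 0) →
      (∀ i, f i y + γ * f i (fun _ => 1) = 0) → ∀ b, y b = γ := by
    intro y γ hy hfy b
    have hz := hZS (fun b => y b + γ) (fun i => by rw [hf_shift]; exact hfy i) (hS_shift y γ hy)
    have := congrFun hz b
    exact F2_eq_of_add_eq_zero₂ this
  refine design_of_stages_dual base τ f (fun b => u b + 1) ?_ ?_ ?_
  · -- (W): `E = Σ e_i f_i` kills `A = ker L ∩ V₀` (pairs `(a,0)`), `1` (pair `(u,1)` against `δ = u + 1`), hence `ker L`, and `Z`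
    intro a e H1 H2
    apply hind
    apply hSZ
    · -- E kills ker L
      have hEA : ∀ s : Fin (k + 1) → ZMod 2, (∀ b, (∑ b', bz (base.neg b b') * (s b' + s b)) = 0) → s b₀ = 0 →
          (∑ i, e i • f i) s = 0 := by
        intro s hs hs0
        obtain ⟨K1, K2⟩ := muOne_kernelPair_of base b₀ hμ (x := s) (y := 0) hs0 (fun i => by
          simp only [Pi.zero_apply]; exact lap_const base 0 i) (fun i => by rw [hs i]; simp)
        have h := H1 s 0 K1 K2
        rw [sum_smul_dual_apply]
        simpa only [map_zero, mul_zero, zero_add] using h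
      have hE1 : (∑ i, e i • f i) (fun _ => 1) = 0 := by
        obtain ⟨K1, K2⟩ := muOne_kernelPair_of base b₀ hμ (x := u) (y := fun _ => 1) hu0 (fun i => lap_const base 1 i)
          (fun i => by rw [hu i, mul_one])
        have h := H1 u (fun _ => 1) K1 K2
        -- H2 : Σ (f i 1 * a i + f i (u+1) * e i) = 0
        have H2' : (∑ i, (f i (fun _ => 1) * a i + (f i u + f i (fun _ => 1)) * e i)) = 0 := by
          have hfu : ∀ i, f i (fun b => u b + 1) = f i u + 1 * f i (fun _ => 1) := fun i => hf_shift i u 1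
          simpa only [hfu, one_mul] using H2
        rw [sum_smul_dual_apply]
        have : (∑ i, e i * f i (fun _ => 1)) =
            (∑ i, (f i (fun _ => 1) * a i + (f i u + f i (fun _ => 1)) * e i)) + ∑ i, (a i * f i (fun _ => 1) + e i * f i u) := by
          rw [← Finset.sum_add_distrib]
          refine Finset.sum_congr rfl fun i _ => ?_
          have h2 : f i (fun _ => 1) * a i + f i (fun _ => 1) * a i = 0 := zmod_two_add_self _
          have h3 : f i u * e i + f i u * e i = 0 := zmod_two_add_self _
          linear_combination -h2 - h3
        rw [this, H2', h, add_zero]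
      intro s hs
      rcases zmod_two_eq_zero_or_eq_one (s b₀) with h0 | h1
      · exact hEA s hs h0
      · have h' := hEA (fun b => s b + 1) (hS_shift s 1 hs) (by show s b₀ + 1 = 0; rw [h1]; decide)
        have hs' : (fun b => s b + 1) = s + (fun _ => (1 : ZMod 2)) := by funext b; simp
        rw [hs', map_add, hE1, add_zero] at h'
        exact h'
    · -- E kills Z
      intro z hz
      rw [sum_smul_dual_apply]
      exact Finset.sum_eq_zero fun i _ => by rw [hz i, mul_zero]
  · -- (U)
    intro x y γ a H1 H2 H3 H4
    -- x_(b₀) = 0 and y ∈ ker L from H2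
    have hx0 : x b₀ = 0 := by
      have hsum : (∑ i, (bz (negNegOne (base.cls i)) * x i + ∑ j, bz (base.neg i j) * (y j + y i))) = 0 :=
        Finset.sum_eq_zero fun i _ => H2 i
      rw [Finset.sum_add_distrib, sum_lap_eq_zero base b₀ hμ y, add_zero] at hsum
      simp only [hm, ite_mul, one_mul, zero_mul, Finset.sum_ite_eq', Finset.mem_univ, if_true] at hsum
      exact hsum
    have hmx : ∀ i, bz (negNegOne (base.cls i)) * x i = 0 := fun i => by
      rw [hm]; split_ifs with h
      · rw [h, hx0, mul_zero]
      · exact zero_mul _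
    have hLy : ∀ b, (∑ b', bz (base.neg b b') * (y b' + y b)) = 0 := fun b => by
      have := H2 b; rwa [hmx b, zero_add] at this
    have hyγ : ∀ b, y b = γ := hy_const y γ hLy H4
    -- s = L x + γ d = L (x + γ u)
    set s : Fin (k + 1) → ZMod 2 := fun b => ∑ i, f i (fun j => if b = j then 1 else 0) * a i with hsdef
    have hs : ∀ b, s b = ∑ b', bz (base.neg b b') * ((x b' + γ * u b') + (x b + γ * u b)) := by
      intro b
      rw [lap_add_smul base x u γ b, hu b]
      have := H1 b
      rw [hmx b, add_zero, hyγ b, mul_comm _ γ] at this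
      exact this.symm
    -- α = Σ a_i f_i kills ker L (adjointness) and Z
    apply hind
    apply hSZ
    · intro v hv
      rw [sum_smul_dual_apply, ← sum_dual_coord_mul f a v]
      show (∑ b, s b * v b) = 0
      simp only [hs]
      have := sum_mul_lap_eq_zero_of_ker base b₀ hμ (fun b => x b + γ * u b) v hv
      simpa only [mul_comm] using this
    · intro z hz
      rw [sum_smul_dual_apply]
      exact Finset.sum_eq_zero fun i _ => by rw [hz i, mul_zero]
  · -- (F)
    intro x y γ hx hy H3 H4
    obtain ⟨hx0, hLy, hLx⟩ := muOne_kernelPair base b₀ hμ hx hy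
    have hyγ : ∀ b, y b = γ := hy_const y γ hLy H4
    -- x + γ u ∈ ker L, and x + γ u + γ 1 ∈ Z ∩ ker L = 0
    have hK : ∀ b, (∑ b', bz (base.neg b b') * ((x b' + γ * u b') + (x b + γ * u b))) = 0 := by
      intro b
      rw [lap_add_smul base x u γ b, hu b, hLx b, hyγ b, mul_comm]
      exact zmod_two_add_self _
    have hZ : ∀ i, f i (fun b => (x b + γ * u b) + γ) = 0 := by
      intro i
      have : (fun b => (x b + γ * u b) + γ) = x + γ • (fun b => u b + 1) := by
        funext b; simp [Pi.add_apply, Pi.smul_apply]; ring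
      rw [this, map_add, map_smul, smul_eq_mul]
      exact H3 i
    have h0 := hZS (fun b => (x b + γ * u b) + γ) hZ (hS_shift _ γ hK)
    have hγ : γ = 0 := by
      have := congrFun h0 b₀
      simp only [hx0, hu0, mul_zero, zero_add, Pi.zero_apply] at this
      exact this
    refine ⟨hγ, ?_, ?_⟩
    · funext b
      have := congrFun h0 b
      simp only [hγ, zero_mul, add_zero, Pi.zero_apply] at this
      exact this
    · funext b; rw [hyγ b, hγ]; rfl

/-- ★★ **THEOREM B, case (α) `⟨d, a₁⟩ = 1` for some `a₁ ∈ A = ker L ∩ V₀`.** A `μ = 1` base with `|d|` even, a kernel vector `a₁`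
(`L a₁ = 0`, `(a₁)_(b₀) = 0`) with `⟨d, a₁⟩ = 1`, and linearly independent linear forms `f_i` cutting out a subspace `Z ∋ 1 + a₁` with
`Z ∩ ker L ⊆ {0, 1 + a₁}` (`hZS`) and `A + Z = V` (`hAZ`: a form killing `A` and `Z` is zero): the design with free cells `f_i` and ANY
`δ` satisfies (W), (U), (F), hence is a pattern-free Heegner recipe with `τ + 1` auxiliary primes. [folklore] -/
theorem muOne_design_alpha (b₀ : Fin (k + 1)) (hμ : ∀ b, negNegOne (base.cls b) = true ↔ b = b₀)
    (hd : (∑ b, bz (negTwo (base.cls b))) = 0)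
    (τ : ℕ) (f : Fin τ → Dual (ZMod 2) (Fin (k + 1) → ZMod 2)) (δ a₁ : Fin (k + 1) → ZMod 2)
    (hind : ∀ e : Fin τ → ZMod 2, (∑ i, e i • f i) = 0 → ∀ i, e i = 0)
    (ha₁S : ∀ b, (∑ b', bz (base.neg b b') * (a₁ b' + a₁ b)) = 0) (ha₁0 : a₁ b₀ = 0)
    (hda₁ : (∑ b, bz (negTwo (base.cls b)) * a₁ b) = 1)
    (hz₁ : ∀ i, f i (fun b => 1 + a₁ b) = 0)
    (hZS : ∀ z : Fin (k + 1) → ZMod 2, (∀ i, f i z = 0) → (∀ b, (∑ b', bz (base.neg b b') * (z b' + z b)) = 0) →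
      z = 0 ∨ z = fun b => 1 + a₁ b)
    (hAZ : ∀ φ : Dual (ZMod 2) (Fin (k + 1) → ZMod 2),
      (∀ a : Fin (k + 1) → ZMod 2, (∀ b, (∑ b', bz (base.neg b b') * (a b' + a b)) = 0) → a b₀ = 0 → φ a = 0) →
      (∀ z : Fin (k + 1) → ZMod 2, (∀ i, f i z = 0) → φ z = 0) → φ = 0) :
    ∃ (c₁ : AuxCell) (rest : List AuxCell), rest.length = τ ∧ heegnerK base (c₁ :: rest) = true ∧
      ∀ pat : ℕ → ℕ → Bool, (dataK base (c₁ :: rest) pat).monskyOddS.det = 1 := by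
  classical
  have hm := bz_negNegOne_eq base b₀ hμ
  have hS_shift : ∀ (y : Fin (k + 1) → ZMod 2) (γ : ZMod 2), (∀ b, (∑ b', bz (base.neg b b') * (y b' + y b)) = 0) →
      ∀ b, (∑ b', bz (base.neg b b') * ((y b' + γ) + (y b + γ))) = 0 := fun y γ hy b => by
    rw [lap_add_const base y γ b]; exact hy b
  have hf_shift : ∀ i (y : Fin (k + 1) → ZMod 2) (γ : ZMod 2), f i (fun b => y b + γ) = f i y + γ * f i (fun _ => 1) := by
    intro i y γ
    have : (fun b => y b + γ) = y + γ • (fun _ => (1 : ZMod 2)) := by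
      funext b; simp [Pi.add_apply, Pi.smul_apply]
    rw [this, map_add, map_smul, smul_eq_mul]
  -- `d` is not in the image of `L`: `⟨d, a₁⟩ = ⟨L x, a₁⟩ = ⟨x, L a₁⟩ = 0` otherwise
  have hd_not_image : ∀ x : Fin (k + 1) → ZMod 2, ¬ ∀ b, (∑ b', bz (base.neg b b') * (x b' + x b)) = bz (negTwo (base.cls b)) := by
    intro x hx
    have h0 := sum_mul_lap_eq_zero_of_ker base b₀ hμ x a₁ ha₁S
    simp only [hx] at h0
    have : (∑ b, bz (negTwo (base.cls b)) * a₁ b) = 0 := by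
      rw [← h0]; exact Finset.sum_congr rfl fun b _ => mul_comm _ _
    rw [this] at hda₁
    exact zero_ne_one hda₁
  -- `Σ_b d_b (c + a₁ b) = 1` for every constant `c` (|d| even, ⟨d,a₁⟩ = 1)
  have hd_shift : ∀ c : ZMod 2, (∑ b, bz (negTwo (base.cls b)) * (c + a₁ b)) = 1 := by
    intro c
    have : (∑ b, bz (negTwo (base.cls b)) * (c + a₁ b)) = c * (∑ b, bz (negTwo (base.cls b))) + ∑ b, bz (negTwo (base.cls b)) * a₁ b := by
      rw [Finset.mul_sum, ← Finset.sum_add_distrib]; exact Finset.sum_congr rfl fun b _ => by ring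
    rw [this, hd, hda₁, mul_zero, zero_add]
  -- dichotomy for `y ∈ ker L` with `y + γ1 ∈ Z`
  have hy_cases : ∀ (y : Fin (k + 1) → ZMod 2) (γ : ZMod 2), (∀ b, (∑ b', bz (base.neg b b') * (y b' + y b)) = 0) →
      (∀ i, f i y + γ * f i (fun _ => 1) = 0) → (∀ b, y b = γ) ∨ (∀ b, y b = (1 + γ) + a₁ b) := by
    intro y γ hy hfy
    rcases hZS (fun b => y b + γ) (fun i => by rw [hf_shift]; exact hfy i) (hS_shift y γ hy) with h | h
    · left; intro b; exact F2_eq_of_add_eq_zero₂ (congrFun h b)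
    · right; intro b
      have hb : y b + γ = 1 + a₁ b := congrFun h b
      have hγ : γ + γ = 0 := zmod_two_add_self γ
      linear_combination hb - hγ
  refine design_of_stages_dual base τ f δ ?_ ?_ ?_
  · -- (W): `E = Σ e_i f_i` kills `A` (pairs `(a,0)`) and `Z`; `A + Z = V`
    intro a e H1 _H2
    apply hind
    apply hAZ
    · intro s hs hs0
      obtain ⟨K1, K2⟩ := muOne_kernelPair_of base b₀ hμ (x := s) (y := 0) hs0 (fun i => by
        simp only [Pi.zero_apply]; exact lap_const base 0 i) (fun i => by rw [hs i]; simp)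
      have h := H1 s 0 K1 K2
      rw [sum_smul_dual_apply]
      simpa only [map_zero, mul_zero, zero_add] using h
    · intro z hz
      rw [sum_smul_dual_apply]
      exact Finset.sum_eq_zero fun i _ => by rw [hz i, mul_zero]
  · -- (U)
    intro x y γ a H1 H2 H3 H4
    have hx0 : x b₀ = 0 := by
      have hsum : (∑ i, (bz (negNegOne (base.cls i)) * x i + ∑ j, bz (base.neg i j) * (y j + y i))) = 0 :=
        Finset.sum_eq_zero fun i _ => H2 i
      rw [Finset.sum_add_distrib, sum_lap_eq_zero base b₀ hμ y, add_zero] at hsum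
      simp only [hm, ite_mul, one_mul, zero_mul, Finset.sum_ite_eq', Finset.mem_univ, if_true] at hsum
      exact hsum
    have hmx : ∀ i, bz (negNegOne (base.cls i)) * x i = 0 := fun i => by
      rw [hm]; split_ifs with h
      · rw [h, hx0, mul_zero]
      · exact zero_mul _
    have hLy : ∀ b, (∑ b', bz (base.neg b b') * (y b' + y b)) = 0 := fun b => by
      have := H2 b; rwa [hmx b, zero_add] at this
    set s : Fin (k + 1) → ZMod 2 := fun b => ∑ i, f i (fun j => if b = j then 1 else 0) * a i with hsdef
    -- `s = L x + D_d y`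
    have hs : ∀ b, s b = (∑ b', bz (base.neg b b') * (x b' + x b)) + bz (negTwo (base.cls b)) * y b := by
      intro b; have := H1 b; rw [hmx b, add_zero] at this; exact this.symm
    -- `α := Σ a_i f_i`: `α v = ⟨s, v⟩`, `α 1 = 0` (H3), `α` kills `Z`
    have hαv : ∀ v, (∑ i, a i • f i) v = ∑ b, s b * v b := fun v => by
      rw [sum_smul_dual_apply, ← sum_dual_coord_mul f a v]
    have hα1 : (∑ b, s b) = 0 := by
      have := hαv (fun _ => 1)
      simp only [mul_one] at this
      rw [← this, sum_smul_dual_apply, ← H3]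
      exact Finset.sum_congr rfl fun i _ => mul_comm _ _
    have hαZ : ∀ z : Fin (k + 1) → ZMod 2, (∀ i, f i z = 0) → (∑ b, s b * z b) = 0 := fun z hz => by
      rw [← hαv, sum_smul_dual_apply]; exact Finset.sum_eq_zero fun i _ => by rw [hz i, mul_zero]
    rcases hy_cases y γ hLy H4 with hyγ | hyz
    · -- y = γ1, s = Lx + γ d
      rcases zmod_two_eq_zero_or_eq_one γ with hγ | hγ
      · -- s = Lx: α kills A ⊆ ker L and Z ⇒ α = 0
        apply hind
        apply hAZ
        · intro v hv _
          rw [hαv]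
          simp only [hs, hyγ, hγ, mul_zero, add_zero]
          have := sum_mul_lap_eq_zero_of_ker base b₀ hμ x v hv
          simpa only [mul_comm] using this
        · intro z hz; rw [hαv]; exact hαZ z hz
      · -- s = Lx + d: ⟨s, a₁⟩ = 1 but ⟨s, a₁⟩ = ⟨s, 1 + a₁⟩ + ⟨s, 1⟩ = 0
        exfalso
        have h1 : (∑ b, s b * a₁ b) = 1 := by
          simp only [hs, hyγ, hγ, mul_one, add_mul]
          rw [Finset.sum_add_distrib]
          have h0 : (∑ b, (∑ b', bz (base.neg b b') * (x b' + x b)) * a₁ b) = 0 := by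
            have := sum_mul_lap_eq_zero_of_ker base b₀ hμ x a₁ ha₁S
            simpa only [mul_comm] using this
          rw [h0, zero_add, hda₁]
        have h2 : (∑ b, s b * a₁ b) = (∑ b, s b * (1 + a₁ b)) + ∑ b, s b := by
          rw [← Finset.sum_add_distrib]; refine Finset.sum_congr rfl fun b _ => ?_
          have : s b + s b = 0 := zmod_two_add_self _
          linear_combination -this
        rw [h2, hαZ _ hz₁, hα1, add_zero] at h1
        exact zero_ne_one h1
    · -- y = (1+γ)1 + a₁: ⟨s, 1⟩ = (1+γ)|d| + ⟨d, a₁⟩ = 1, contradiction with α 1 = 0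
      exfalso
      have h1 : (∑ b, s b) = 1 := by
        simp only [hs, hyz]
        rw [Finset.sum_add_distrib, sum_lap_eq_zero base b₀ hμ x, zero_add]
        exact hd_shift (1 + γ)
      rw [hα1] at h1
      exact zero_ne_one h1
  · -- (F)
    intro x y γ hx hy H3 H4
    obtain ⟨hx0, hLy, hLx⟩ := muOne_kernelPair base b₀ hμ hx hy
    rcases hy_cases y γ hLy H4 with hyγ | hyz
    · rcases zmod_two_eq_zero_or_eq_one γ with hγ | hγ
      · -- γ = 0: y = 0, x ∈ ker L ∩ V₀ ∩ Z = 0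
        have hy0 : y = 0 := by funext b; rw [hyγ b, hγ]; rfl
        have hLx0 : ∀ b, (∑ b', bz (base.neg b b') * (x b' + x b)) = 0 := fun b => by
          rw [hLx b, hyγ b, hγ, mul_zero]
        have hxZ : ∀ i, f i x = 0 := fun i => by have := H3 i; rwa [hγ, zero_mul, add_zero] at this
        refine ⟨hγ, ?_, hy0⟩
        rcases hZS x hxZ hLx0 with h | h
        · exact h
        · exfalso
          have := congrFun h b₀
          rw [hx0, ha₁0, add_zero] at this
          exact zero_ne_one this
      · -- γ = 1: L x = d, impossible
        exfalso
        exact hd_not_image x fun b => by rw [hLx b, hyγ b, hγ, mul_one]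
    · -- y = (1+γ)1 + a₁: Σ_b (Lx)_b = 0 but = Σ d_b y_b = 1
      exfalso
      have h1 : (∑ b, ∑ b', bz (base.neg b b') * (x b' + x b)) = 1 := by
        simp only [hLx, hyz]; exact hd_shift (1 + γ)
      rw [sum_lap_eq_zero base b₀ hμ x] at h1
      exact zero_ne_one h1

end MuOneDesign

end Summit.BirchSwinnertonDyer.BirchSwinnertonDyer.Theorems.SymbolicMonsky
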